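import Mathlib.LinearAlgebra.FreeModule.IdealQuotient
import Literature.NumberTheory.LFunctions.HeckeThetaPieces
import HarnessLib

/-!
# Units of the narrow ray modulo `𝔪` and their exponent vectors

Topic `Literature/NumberTheory/LFunctions`; namespace `Literature.NumberTheory.LFunctions.NumberField`
(continuing `HeckeThetaPieces.lean`).  Bookkeeping for the passage from the representatives modulo
`V = ⟨u_i^N⟩` used in the analytic unfolding to the orbits of the group
`U_𝔪⁺ = {ε ∈ 𝒪^* | ε ≡ 1 mod 𝔪, ε ≫ 0}` that parametrise the ideals of a narrow ray class
(Neukirch VII §8 Remark 1 with VI (1.7), (1.9)):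

* `narrowUnits 𝔪` — the subgroup `U_𝔪⁺`; `rayModExp 𝔪 = 2·#(𝒪/𝔪)^*`, an even exponent with
  `u^{rayModExp 𝔪} ≡ 1 mod 𝔪` for every unit (`unit_pow_rayModExp_sub_one_mem`), so that
  `V = ⟨u_i^{rayModExp 𝔪}⟩ ≤ U_𝔪⁺` (`fundUnit_nsmul_mem_narrowUnits`);
* `unitExp ε ∈ ℤ^{r-1}` — the exponent vector of Dirichlet's decomposition `ε = ζ ∏ u_i^{e_i}`
  (Mathlib `exist_unique_eq_mul_prod`), with `unitExp (ε u_m) = unitExp ε + m` and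
  `m(εx) = m(x) - unitExp ε` for the cone exponent (`coneExp_unit_mul`);
* `expBox 𝔪 N m = {ε ∈ U_𝔪⁺ | m - unitExp ε ∈ [0,N)^{r-1}}` — these finite nonempty sets are pairwise in
  bijection (`expBoxEquiv`), so their common size `rayFibreCard 𝔪 N ≥ 1` is independent of `m`
  (`card_expBox`): the size of the fibres of "representative ↦ ideal" in `RayClassBridge.lean`.

## References

* J. Neukirch, *Algebraic Number Theory*, Grundlehren 322, Springer 1999, Ch. VI §1 (1.7)–(1.9),
  Ch. VII §8 Remark 1. [NeukirchANT1999]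
-/

noncomputable section

open NumberField NumberField.InfinitePlace NumberField.mixedEmbedding NumberField.Units
open scoped NumberField nonZeroDivisors

namespace Literature.NumberTheory.LFunctions

namespace NumberField

variable {K : Type*} [Field K] [NumberField K]

open scoped Classical

open NumberField.mixedEmbedding NumberField.mixedEmbedding.fundamentalCone
  NumberField.Units.dirichletUnitTheorem

/-! ## The group `U_𝔪⁺` -/

omit [NumberField K] in
/-- Casting a product of integers to `K`. [folklore] -/
theorem coe_unit_inv_mul_self (ε : (𝓞 K)ˣ) :
    (((ε⁻¹ : (𝓞 K)ˣ) : 𝓞 K) : K) * ((ε : 𝓞 K) : K) = 1 := by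
  have := congrArg (fun z : 𝓞 K ↦ (z : K)) (Units.inv_mul ε)
  push_cast at this
  exact this

/-- **`U_𝔪⁺`**: the units `ε ≡ 1 mod 𝔪` that are totally positive (the units of the ray `mod 𝔪`,
Neukirch VI (1.7)). [cite: NeukirchANT1999, Ch. VI §1 (1.7)] -/
def narrowUnits (𝔪 : Ideal (𝓞 K)) : Subgroup (𝓞 K)ˣ where
  carrier := {ε | (ε : 𝓞 K) - 1 ∈ 𝔪 ∧ ∀ φ : K →+* ℝ, 0 < φ ((ε : 𝓞 K) : K)}
  mul_mem' {ε η} hε hη := by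
    refine ⟨?_, fun φ ↦ ?_⟩
    · have : ((ε * η : (𝓞 K)ˣ) : 𝓞 K) - 1 = (ε : 𝓞 K) * ((η : 𝓞 K) - 1) + ((ε : 𝓞 K) - 1) := by
        push_cast; ring
      rw [this]
      exact 𝔪.add_mem (𝔪.mul_mem_left _ hη.1) hε.1
    · have : φ (((ε * η : (𝓞 K)ˣ) : 𝓞 K) : K) = φ ((ε : 𝓞 K) : K) * φ ((η : 𝓞 K) : K) := by
        rw [← map_mul]; push_cast; rfl
      rw [this]
      exact mul_pos (hε.2 φ) (hη.2 φ)
  one_mem' := ⟨by simp, fun φ ↦ by simp⟩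
  inv_mem' {ε} hε := by
    refine ⟨?_, fun φ ↦ ?_⟩
    · have : ((ε⁻¹ : (𝓞 K)ˣ) : 𝓞 K) - 1 = -(((ε⁻¹ : (𝓞 K)ˣ) : 𝓞 K) * ((ε : 𝓞 K) - 1)) := by
        rw [mul_sub, Units.inv_mul, mul_one]; ring
      rw [this]
      exact 𝔪.neg_mem (𝔪.mul_mem_left _ hε.1)
    · have h2 : φ (((ε⁻¹ : (𝓞 K)ˣ) : 𝓞 K) : K) * φ ((ε : 𝓞 K) : K) = 1 := by
        rw [← map_mul, coe_unit_inv_mul_self, map_one]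
      rw [eq_inv_of_mul_eq_one_left h2]
      exact inv_pos.mpr (hε.2 φ)

omit [NumberField K] in
/-- Membership in `U_𝔪⁺`. [folklore] -/
theorem mem_narrowUnits {𝔪 : Ideal (𝓞 K)} {ε : (𝓞 K)ˣ} :
    ε ∈ narrowUnits 𝔪 ↔ (ε : 𝓞 K) - 1 ∈ 𝔪 ∧ ∀ φ : K →+* ℝ, 0 < φ ((ε : 𝓞 K) : K) := Iff.rfl

/-! ## The exponent `N = 2·#(𝒪/𝔪)^*` -/

variable (K) in
/-- **`N_𝔪 = 2 · #(𝒪/𝔪)^*`**: an even exponent killing every unit modulo `𝔪`. [folklore] -/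
def rayModExp (𝔪 : Ideal (𝓞 K)) : ℕ := 2 * Nat.card ((𝓞 K ⧸ 𝔪)ˣ)

omit [NumberField K] in
/-- `N_𝔪` is even. [folklore] -/
theorem even_rayModExp (𝔪 : Ideal (𝓞 K)) : Even (rayModExp K 𝔪) := even_two_mul _

/-- `N_𝔪 ≠ 0` (the quotient `𝒪/𝔪` is finite for `𝔪 ≠ 0`). [folklore] -/
theorem rayModExp_ne_zero {𝔪 : Ideal (𝓞 K)} (h𝔪 : 𝔪 ≠ ⊥) : rayModExp K 𝔪 ≠ 0 := by
  haveI : Finite (𝓞 K ⧸ 𝔪) := Ideal.finiteQuotientOfFreeOfNeBot 𝔪 h𝔪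
  haveI : Finite ((𝓞 K ⧸ 𝔪)ˣ) := Finite.of_injective _ Units.val_injective
  have : 0 < Nat.card ((𝓞 K ⧸ 𝔪)ˣ) := Nat.card_pos
  unfold rayModExp; omega

omit [NumberField K] in
/-- **Every unit satisfies `u^{N_𝔪} ≡ 1 mod 𝔪`** (Lagrange in `(𝒪/𝔪)^*` — with `Nat.card = 0` for an
infinite quotient the statement is trivial —, then square). [folklore] -/
theorem unit_pow_rayModExp_sub_one_mem (𝔪 : Ideal (𝓞 K)) (u : (𝓞 K)ˣ) :
    (u : 𝓞 K) ^ rayModExp K 𝔪 - 1 ∈ 𝔪 := by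
  set n := Nat.card ((𝓞 K ⧸ 𝔪)ˣ) with hn
  -- `u^n ≡ 1 mod 𝔪`
  have h1 : (u : 𝓞 K) ^ n - 1 ∈ 𝔪 := by
    have hU : (Units.map (Ideal.Quotient.mk 𝔪 : 𝓞 K →* 𝓞 K ⧸ 𝔪) u) ^ n = 1 := pow_card_eq_one'
    have hU' : (Ideal.Quotient.mk 𝔪 ((u : 𝓞 K) ^ n)) = 1 := by
      have := congrArg Units.val hU
      simpa using this
    rw [← Ideal.Quotient.eq_zero_iff_mem, map_sub, hU', map_one, sub_self]
  have : (u : 𝓞 K) ^ rayModExp K 𝔪 - 1 = ((u : 𝓞 K) ^ n - 1) * ((u : 𝓞 K) ^ n + 1) := by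
    rw [rayModExp, ← hn]; ring
  rw [this]
  exact 𝔪.mul_mem_right _ h1

/-- `u_{Nq} = (u_q)^N`. [folklore] -/
theorem fundUnit_nsmul (N : ℕ) (q : Fin (rank K) → ℤ) : fundUnit K (N • q) = fundUnit K q ^ N := by
  simp only [fundUnit, ← Finset.prod_pow]
  refine Finset.prod_congr rfl fun i _ ↦ ?_
  rw [Pi.smul_apply, nsmul_eq_mul, mul_comm, zpow_mul, zpow_natCast]

/-- **`V = ⟨u_i^{N_𝔪}⟩ ≤ U_𝔪⁺`**: `u_{N_𝔪 q}` is `≡ 1 mod 𝔪` and, being a square, totally positive.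
[folklore] -/
theorem fundUnit_nsmul_mem_narrowUnits (𝔪 : Ideal (𝓞 K)) (q : Fin (rank K) → ℤ) :
    fundUnit K (rayModExp K 𝔪 • q) ∈ narrowUnits 𝔪 := by
  refine ⟨?_, fun φ ↦ ?_⟩
  · rw [fundUnit_nsmul, Units.val_pow_eq_pow_val]
    exact unit_pow_rayModExp_sub_one_mem 𝔪 _
  · have hsq := fundUnit_nsmul_eq_sq (K := K) (even_rayModExp 𝔪) q
    have hne : φ ((fundUnit K ((rayModExp K 𝔪 / 2) • q) : K)) ≠ 0 :=
      (map_ne_zero φ).mpr (Units.coe_ne_zero _)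
    have : φ (((fundUnit K (rayModExp K 𝔪 • q) : (𝓞 K)ˣ) : 𝓞 K) : K) =
        φ ((fundUnit K ((rayModExp K 𝔪 / 2) • q) : K)) ^ 2 := by
      rw [← map_pow, ← hsq]
    rw [this]
    exact sq_pos_iff.mpr hne

/-! ## Exponent vectors of units -/

variable (K) in
/-- **Dirichlet's decomposition `ε = ζ · u_e`** of a unit (`ζ` a root of unity, `e ∈ ℤ^{r-1}`), chosen
via Mathlib's `exist_unique_eq_mul_prod`. [folklore] -/
def unitDecomp (ε : (𝓞 K)ˣ) : NumberField.Units.torsion K × (Fin (rank K) → ℤ) :=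
  (exist_unique_eq_mul_prod K ε).exists.choose

/-- The defining property of `unitDecomp`. [folklore] -/
theorem unitDecomp_spec (ε : (𝓞 K)ˣ) : ε = ((unitDecomp K ε).1 : (𝓞 K)ˣ) * fundUnit K (unitDecomp K ε).2 :=
  (exist_unique_eq_mul_prod K ε).exists.choose_spec

/-- Uniqueness of Dirichlet's decomposition. [folklore] -/
theorem unitDecomp_unique {ε : (𝓞 K)ˣ} {ζ : NumberField.Units.torsion K} {e : Fin (rank K) → ℤ}
    (h : ε = (ζ : (𝓞 K)ˣ) * fundUnit K e) : unitDecomp K ε = (ζ, e) :=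
  (exist_unique_eq_mul_prod K ε).unique (unitDecomp_spec ε) h

variable (K) in
/-- **The exponent vector of a unit** in Dirichlet's decomposition `ε = ζ ∏ u_i^{e_i}`. [folklore] -/
def unitExp (ε : (𝓞 K)ˣ) : Fin (rank K) → ℤ := (unitDecomp K ε).2

/-- Dirichlet's decomposition `ε = ζ · u_{unitExp ε}` with `ζ` a root of unity. [folklore] -/
theorem exists_torsion_mul_fundUnit (ε : (𝓞 K)ˣ) :
    ∃ ζ ∈ NumberField.Units.torsion K, ε = ζ * fundUnit K (unitExp K ε) :=
  ⟨(unitDecomp K ε).1, (unitDecomp K ε).1.2, unitDecomp_spec ε⟩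

/-- **`unitExp (ε u_m) = unitExp ε + m`** (uniqueness of the exponents). [folklore] -/
theorem unitExp_mul_fundUnit (ε : (𝓞 K)ˣ) (m : Fin (rank K) → ℤ) :
    unitExp K (ε * fundUnit K m) = unitExp K ε + m := by
  have h : ε * fundUnit K m = ((unitDecomp K ε).1 : (𝓞 K)ˣ) * fundUnit K (unitExp K ε + m) := by
    rw [fundUnit_add, ← mul_assoc, show unitExp K ε = (unitDecomp K ε).2 from rfl, ← unitDecomp_spec ε]
  have := unitDecomp_unique h
  rw [show unitExp K (ε * fundUnit K m) = (unitDecomp K (ε * fundUnit K m)).2 from rfl, this]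

/-- Roots of unity do not move the cone exponent: `m(ζ y) = m(y)`. [folklore] -/
theorem coneExp_torsion_mul {ζ : (𝓞 K)ˣ} (hζ : ζ ∈ NumberField.Units.torsion K) {y : K} (hy : y ≠ 0) :
    coneExp ((ζ : K) * y) = coneExp y := by
  have hζy : (ζ : K) * y ≠ 0 := mul_ne_zero (Units.coe_ne_zero _) hy
  rw [coneExp_of_ne_zero hζy, coneExp_of_ne_zero hy]
  refine coneExponent_eq hζy ?_
  have : (fundUnit K (coneExponent y hy) : K) * ((ζ : K) * y) = (ζ : K) * ((fundUnit K (coneExponent y hy) : K) * y) := by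
    ring
  rw [this, mixedEmbedding_unit_mul]
  exact torsion_smul_mem_of_mem (coneExponent_spec y hy) hζ

/-- **`m(ε x) = m(x) - unitExp ε`** for a unit `ε` and `x ≠ 0`. [folklore] -/
theorem coneExp_unit_mul (ε : (𝓞 K)ˣ) {x : K} (hx : x ≠ 0) :
    coneExp ((ε : K) * x) = coneExp x - unitExp K ε := by
  obtain ⟨ζ, hζ, h⟩ := exists_torsion_mul_fundUnit ε
  have hux : (fundUnit K (unitExp K ε) : K) * x ≠ 0 := mul_ne_zero (Units.coe_ne_zero _) hx
  have hεx : (ε : K) * x = (ζ : K) * ((fundUnit K (unitExp K ε) : K) * x) := by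
    nth_rewrite 1 [h]
    rw [coe_mul, mul_assoc]
  rw [hεx, coneExp_torsion_mul hζ hux, coneExp_fundUnit_mul _ hx]

/-! ## The exponent boxes and their common cardinality -/

variable (K) in
/-- **The exponent box** `{ε ∈ U_𝔪⁺ | m - unitExp ε ∈ [0,N)^{r-1}}`. [folklore] -/
def expBox (𝔪 : Ideal (𝓞 K)) (N : ℕ) (m : Fin (rank K) → ℤ) : Set (𝓞 K)ˣ :=
  {ε | ε ∈ narrowUnits 𝔪 ∧ ∀ i, (m - unitExp K ε) i ∈ Set.Ico (0 : ℤ) N}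

/-- Reduction into the box: `m' - unitExp (ε u_{N ⌊(m' - unitExp ε)/N⌋}) = (m' - unitExp ε) mod N`.
[folklore] -/
theorem sub_unitExp_mul_fundUnit_mem_Ico {N : ℕ} (hN0 : N ≠ 0) (ε : (𝓞 K)ˣ) (m' : Fin (rank K) → ℤ)
    (i : Fin (rank K)) :
    (m' - unitExp K (ε * fundUnit K (N • fun j ↦ (m' - unitExp K ε) j / (N : ℤ)))) i ∈ Set.Ico (0 : ℤ) N := by
  rw [unitExp_mul_fundUnit, Pi.sub_apply, Pi.add_apply, Pi.smul_apply, nsmul_eq_mul]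
  have hNpos : (0 : ℤ) < N := by exact_mod_cast Nat.pos_of_ne_zero hN0
  have h1 := Int.emod_nonneg ((m' - unitExp K ε) i) hNpos.ne'
  have h2 := Int.emod_lt_of_pos ((m' - unitExp K ε) i) hNpos
  have h3 := Int.emod_add_mul_ediv ((m' - unitExp K ε) i) N
  simp only [Pi.sub_apply] at h1 h2 h3 ⊢
  constructor <;> linarith

/-- The quotient is `-q` after multiplying a box element by `u_{Nq}`. [folklore] -/
theorem sub_unitExp_mul_fundUnit_ediv {N : ℕ} (hN0 : N ≠ 0) {ε : (𝓞 K)ˣ} {m : Fin (rank K) → ℤ}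
    (hbox : ∀ i, (m - unitExp K ε) i ∈ Set.Ico (0 : ℤ) N) (q : Fin (rank K) → ℤ) (i : Fin (rank K)) :
    (m - unitExp K (ε * fundUnit K (N • q))) i / (N : ℤ) = -q i := by
  rw [unitExp_mul_fundUnit, Pi.sub_apply, Pi.add_apply, Pi.smul_apply, nsmul_eq_mul]
  have h0 : (m - unitExp K ε) i / (N : ℤ) = 0 := Int.ediv_eq_zero_of_lt (hbox i).1 (hbox i).2
  rw [Pi.sub_apply] at h0
  have hN' : (N : ℤ) ≠ 0 := by exact_mod_cast hN0
  rw [show m i - (unitExp K ε i + (N : ℤ) * q i) = (m i - unitExp K ε i) + (N : ℤ) * (-q i) by ring,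
    Int.add_mul_ediv_left _ _ hN', h0, zero_add]

/-- **All exponent boxes are in bijection** (`ε ↦ ε · u_{Nq}` with `q` the box reduction), for
`N = N_𝔪` (so that `u_{Nq} ∈ U_𝔪⁺`). [folklore] -/
def expBoxEquiv {𝔪 : Ideal (𝓞 K)} (h𝔪 : 𝔪 ≠ ⊥) (m m' : Fin (rank K) → ℤ) :
    expBox K 𝔪 (rayModExp K 𝔪) m ≃ expBox K 𝔪 (rayModExp K 𝔪) m' where
  toFun ε := ⟨ε.1 * fundUnit K (rayModExp K 𝔪 • fun j ↦ (m' - unitExp K ε.1) j / (rayModExp K 𝔪 : ℤ)),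
    (narrowUnits 𝔪).mul_mem ε.2.1 (fundUnit_nsmul_mem_narrowUnits 𝔪 _),
    fun i ↦ sub_unitExp_mul_fundUnit_mem_Ico (rayModExp_ne_zero h𝔪) _ _ i⟩
  invFun ε := ⟨ε.1 * fundUnit K (rayModExp K 𝔪 • fun j ↦ (m - unitExp K ε.1) j / (rayModExp K 𝔪 : ℤ)),
    (narrowUnits 𝔪).mul_mem ε.2.1 (fundUnit_nsmul_mem_narrowUnits 𝔪 _),
    fun i ↦ sub_unitExp_mul_fundUnit_mem_Ico (rayModExp_ne_zero h𝔪) _ _ i⟩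
  left_inv ε := by
    refine Subtype.ext ?_
    change ε.1 * fundUnit K _ * fundUnit K _ = ε.1
    have hq : (fun j ↦ (m - unitExp K (ε.1 * fundUnit K (rayModExp K 𝔪 • fun j ↦
        (m' - unitExp K ε.1) j / (rayModExp K 𝔪 : ℤ)))) j / (rayModExp K 𝔪 : ℤ)) =
        -(fun j ↦ (m' - unitExp K ε.1) j / (rayModExp K 𝔪 : ℤ)) := by
      funext j
      rw [Pi.neg_apply]
      exact sub_unitExp_mul_fundUnit_ediv (rayModExp_ne_zero h𝔪) ε.2.2 _ j
    rw [hq, smul_neg, fundUnit_neg, mul_assoc, mul_inv_cancel, mul_one]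
  right_inv ε := by
    refine Subtype.ext ?_
    change ε.1 * fundUnit K _ * fundUnit K _ = ε.1
    have hq : (fun j ↦ (m' - unitExp K (ε.1 * fundUnit K (rayModExp K 𝔪 • fun j ↦
        (m - unitExp K ε.1) j / (rayModExp K 𝔪 : ℤ)))) j / (rayModExp K 𝔪 : ℤ)) =
        -(fun j ↦ (m - unitExp K ε.1) j / (rayModExp K 𝔪 : ℤ)) := by
      funext j
      rw [Pi.neg_apply]
      exact sub_unitExp_mul_fundUnit_ediv (rayModExp_ne_zero h𝔪) ε.2.2 _ j
    rw [hq, smul_neg, fundUnit_neg, mul_assoc, mul_inv_cancel, mul_one]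

/-- **The exponent boxes are finite** (`ε ↦ (ζ_ε, unitExp ε)` is injective into
`μ(K) × (m - [0,N)^{r-1})`). [folklore] -/
theorem finite_expBox (𝔪 : Ideal (𝓞 K)) (N : ℕ) (m : Fin (rank K) → ℤ) : Finite (expBox K 𝔪 N m) := by
  have hB : Set.Finite {e : Fin (rank K) → ℤ | ∀ i, (m - e) i ∈ Set.Ico (0 : ℤ) N} := by
    have : {e : Fin (rank K) → ℤ | ∀ i, (m - e) i ∈ Set.Ico (0 : ℤ) N} ⊆
        Set.univ.pi fun i ↦ Set.Ioc (m i - N) (m i) := by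
      intro e he
      simp only [Set.mem_pi, Set.mem_univ, true_implies, Set.mem_Ioc]
      intro i
      have := he i
      simp only [Pi.sub_apply, Set.mem_Ico] at this
      constructor <;> linarith
    exact (Set.Finite.pi fun i ↦ Set.finite_Ioc _ _).subset this
  haveI : Finite {e : Fin (rank K) → ℤ | ∀ i, (m - e) i ∈ Set.Ico (0 : ℤ) N} := hB.to_subtype
  -- choose the root of unity of each unit
  have hdec := fun ε : (𝓞 K)ˣ ↦ exists_torsion_mul_fundUnit ε
  choose ζ hζ hε using hdec
  refine Finite.of_injective (fun ε : expBox K 𝔪 N m ↦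
    ((⟨ζ ε.1, hζ ε.1⟩ : NumberField.Units.torsion K), (⟨unitExp K ε.1, ε.2.2⟩ :
      {e : Fin (rank K) → ℤ | ∀ i, (m - e) i ∈ Set.Ico (0 : ℤ) N}))) fun ε ε' h ↦ ?_
  simp only [Prod.mk.injEq, Subtype.mk.injEq] at h
  refine Subtype.ext ?_
  rw [hε ε.1, hε ε'.1, h.1, h.2]

/-- `1 ∈ expBox 𝔪 N 0` for `N ≠ 0` (`unitExp 1 = 0`). [folklore] -/
theorem one_mem_expBox (𝔪 : Ideal (𝓞 K)) {N : ℕ} (hN0 : N ≠ 0) : (1 : (𝓞 K)ˣ) ∈ expBox K 𝔪 N 0 := by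
  refine ⟨(narrowUnits 𝔪).one_mem, fun i ↦ ?_⟩
  have h1 : unitExp K (1 : (𝓞 K)ˣ) = 0 := by
    have h : (1 : (𝓞 K)ˣ) = ((1 : NumberField.Units.torsion K) : (𝓞 K)ˣ) * fundUnit K 0 := by
      rw [fundUnit_zero, mul_one]; rfl
    rw [unitExp, unitDecomp_unique h]
  rw [h1, sub_zero, Pi.zero_apply]
  exact ⟨le_rfl, by exact_mod_cast Nat.pos_of_ne_zero hN0⟩

variable (K) in
/-- **The fibre cardinality** `d_𝔪 = #(expBox 𝔪 N_𝔪 0) = #{ε ∈ U_𝔪⁺ | -unitExp ε ∈ [0,N_𝔪)^{r-1}}`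
(`= [U_𝔪⁺ : V] · #(μ(K) ∩ U_𝔪⁺)`). [folklore] -/
def rayFibreCard (𝔪 : Ideal (𝓞 K)) : ℕ := Nat.card (expBox K 𝔪 (rayModExp K 𝔪) 0)

/-- Every exponent box has `d_𝔪` elements. [folklore] -/
theorem card_expBox {𝔪 : Ideal (𝓞 K)} (h𝔪 : 𝔪 ≠ ⊥) (m : Fin (rank K) → ℤ) :
    Nat.card (expBox K 𝔪 (rayModExp K 𝔪) m) = rayFibreCard K 𝔪 :=
  Nat.card_congr (expBoxEquiv h𝔪 m 0)

/-- `d_𝔪 ≥ 1`. [folklore] -/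
theorem rayFibreCard_pos {𝔪 : Ideal (𝓞 K)} (h𝔪 : 𝔪 ≠ ⊥) : 0 < rayFibreCard K 𝔪 := by
  haveI := finite_expBox (K := K) 𝔪 (rayModExp K 𝔪) 0
  haveI : Nonempty (expBox K 𝔪 (rayModExp K 𝔪) 0) := ⟨⟨1, one_mem_expBox 𝔪 (rayModExp_ne_zero h𝔪)⟩⟩
  exact Nat.card_pos

end NumberField

end Literature.NumberTheory.LFunctions
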